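import Literature.NumberTheory.GaloisRepresentations.RayClassGroupModulusChange
import HarnessLib

/-!
# `#Cl_K^{𝔪'} · [U_𝔪¹ : U_{𝔪'}¹] = #Cl_K^{𝔪} · #ker((𝓞/𝔪')ˣ → (𝓞/𝔪)ˣ)` — change of modulus
# with the unit index (Neukirch VI (1.11) / de Shalit II.1.9 without `w_𝔪 = 1`)

`RayClassGroupModulusChange.lean` proved `#Cl_K^{𝔪'} = #Cl_K^{𝔪} · #ker((𝓞/𝔪')ˣ → (𝓞/𝔪)ˣ)` for a
totally complex `K` and `𝔪' ≤ 𝔪` with the same prime divisors UNDER `w_𝔪 = 1` (no unit `≠ 1` is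
`≡ 1 mod 𝔪`). This file removes that hypothesis: in general the kernel classes represented by global
units `≡ 1 mod 𝔪` die in `P^𝔪/P^{𝔪'}`, and the exact sequence
`U_𝔪¹/U_{𝔪'}¹ ↪ ker((𝓞/𝔪')ˣ → (𝓞/𝔪)ˣ) ↠ P^𝔪/P^{𝔪'}` (`U_𝔪¹ = {u ∈ 𝓞ˣ : u ≡ 1 mod 𝔪}`, the
kernel of `𝓞ˣ → (𝓞/𝔪)ˣ`) gives

* `quotientGroupMk_ray_eq_of_sub_mem` — `b ≡ a mod 𝔪' ⟹ (a)·P^{𝔪'} = (b)·P^{𝔪'}` (no unit hypothesis);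
* `exists_units_sub_mul_mem_of_quotientGroupMk_ray_eq` — conversely `(a)·P^{𝔪'} = (b)·P^{𝔪'} ⟹
  b ≡ u·a mod 𝔪'` for some global unit `u`;
* ★ `natCard_ker_eq_relIndex_ray_mul_relIndex_units` —
  `#ker((𝓞/𝔪')ˣ → (𝓞/𝔪)ˣ) = [P^𝔪 : P^{𝔪'}] · [U_𝔪¹ : U_{𝔪'}¹]`;
* ★★ `natCard_rayClassGroup_mul_relIndex_units_eq` —
  **`#Cl_K^{𝔪'} · [U_𝔪¹ : U_{𝔪'}¹] = #Cl_K^{𝔪} · #ker((𝓞/𝔪')ˣ → (𝓞/𝔪)ˣ)`**.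

For `K = ℚ(√-7)`, `𝔪 = 𝔭 ∣ 2` split, `𝔪' = 𝔭^{n+1}` (`n ≥ 1`): `U_𝔭¹ = {±1}`, `U_{𝔭^{n+1}}¹ = 1`, so
`#Cl^{𝔭^{n+1}} · 2 = #Cl^{𝔭} · 2^n` — de Shalit's `[K(𝔭^{n+1}) : K(𝔭)] = #((1+𝔭)/(1+𝔭^{n+1}))/[U_𝔭¹:U_{𝔭^{n+1}}¹]`
(the `𝔣 = 1` case, where `w_𝔣 = 1` fails); that instance is drawn in
`NumberFields/RayClassFieldSplitTwoPowerDegree.lean`.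

Everything is a theorem; no definitions, no named facts, no instances, no `sorry`.
-/

noncomputable section

open NumberField IsDedekindDomain IsDedekindDomain.HeightOneSpectrum

open scoped nonZeroDivisors

namespace Literature.NumberTheory.GaloisRepresentations

variable {K : Type*} [Field K] [NumberField K]

section Kernel

variable [IsTotallyComplex K] {𝔪 𝔪' : Ideal (𝓞 K)} (h𝔪 : 𝔪 ≠ ⊥) (h𝔪' : 𝔪' ≠ ⊥) (h𝔪1 : 𝔪' ≠ ⊤)
  (hle : 𝔪' ≤ 𝔪) (hsupp : ∀ v : HeightOneSpectrum (𝓞 K), 𝔪 ≤ v.asIdeal ↔ 𝔪' ≤ v.asIdeal)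

include h𝔪' in
/-- `b ≡ a mod 𝔪'` (`a` invertible mod `𝔪'`) ⟹ the principal ideals `(a)`, `(b)` (in `P^𝔪`) define the
same coset of `P^{𝔪'}` — the half of `quotientGroupMk_ray_eq_iff` that needs no unit hypothesis.
[cite: NeukirchANT1999, Ch. VI §1 Prop. (1.9)] -/
theorem quotientGroupMk_ray_eq_of_sub_mem {a b : 𝓞 K} (ha0 : a ≠ 0) (hb0 : b ≠ 0)
    (ha : IsUnit (Ideal.Quotient.mk 𝔪' a))
    (hau : toPrincipalIdeal (𝓞 K) K (Units.mk0 (a : K) (by exact_mod_cast ha0)) ∈ ray (K := K) 𝔪)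
    (hbu : toPrincipalIdeal (𝓞 K) K (Units.mk0 (b : K) (by exact_mod_cast hb0)) ∈ ray (K := K) 𝔪)
    (h : b - a ∈ 𝔪') :
    (QuotientGroup.mk (s := (ray 𝔪').subgroupOf (ray (K := K) 𝔪)) ⟨_, hau⟩ :
        ↥(ray (K := K) 𝔪) ⧸ (ray 𝔪').subgroupOf (ray (K := K) 𝔪)) = QuotientGroup.mk ⟨_, hbu⟩ := by
  have hacop' : IsCoprime (Ideal.span {a}) 𝔪' := isCoprime_span_of_isUnit_mk ha
  have hq : (Units.mk0 (a : K) (by exact_mod_cast ha0))⁻¹ * Units.mk0 (b : K) (by exact_mod_cast hb0) =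
      Units.mk0 ((b : K) / (a : K)) (div_ne_zero (by exact_mod_cast hb0) (by exact_mod_cast ha0)) :=
    Units.ext (by simp [div_eq_mul_inv, mul_comm])
  rw [QuotientGroup.eq, Subgroup.mem_subgroupOf, Subgroup.coe_mul, Subgroup.coe_inv, ← map_inv,
    ← map_mul, hq]
  exact Subgroup.mem_map.mpr ⟨_, unitsMk0_div_mem_rayElements_of_sub_mem h𝔪' hb0 ha0 hacop' h, rfl⟩

omit [IsTotallyComplex K] in
include h𝔪' in
/-- Conversely, **`(a)·P^{𝔪'} = (b)·P^{𝔪'} ⟹ b ≡ u·a mod 𝔪'` for some global unit `u`** (`(b/a) = (c)`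
with `c ≡ 1 mod 𝔪'` forces `b/a = u·c`). [cite: NeukirchANT1999, Ch. VI §1 Prop. (1.9), (1.11)] -/
theorem exists_units_sub_mul_mem_of_quotientGroupMk_ray_eq {a b : 𝓞 K} (ha0 : a ≠ 0) (hb0 : b ≠ 0)
    (hau : toPrincipalIdeal (𝓞 K) K (Units.mk0 (a : K) (by exact_mod_cast ha0)) ∈ ray (K := K) 𝔪)
    (hbu : toPrincipalIdeal (𝓞 K) K (Units.mk0 (b : K) (by exact_mod_cast hb0)) ∈ ray (K := K) 𝔪)
    (h : (QuotientGroup.mk (s := (ray 𝔪').subgroupOf (ray (K := K) 𝔪)) ⟨_, hau⟩ :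
        ↥(ray (K := K) 𝔪) ⧸ (ray 𝔪').subgroupOf (ray (K := K) 𝔪)) = QuotientGroup.mk ⟨_, hbu⟩) :
    ∃ u : (𝓞 K)ˣ, b - u * a ∈ 𝔪' := by
  have hq : (Units.mk0 (a : K) (by exact_mod_cast ha0))⁻¹ * Units.mk0 (b : K) (by exact_mod_cast hb0) =
      Units.mk0 ((b : K) / (a : K)) (div_ne_zero (by exact_mod_cast hb0) (by exact_mod_cast ha0)) :=
    Units.ext (by simp [div_eq_mul_inv, mul_comm])
  rw [QuotientGroup.eq, Subgroup.mem_subgroupOf, Subgroup.coe_mul, Subgroup.coe_inv, ← map_inv,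
    ← map_mul, hq] at h
  obtain ⟨c, hc, hcq⟩ := Subgroup.mem_map.mp h
  have hker : c⁻¹ * Units.mk0 ((b : K) / (a : K))
      (div_ne_zero (by exact_mod_cast hb0) (by exact_mod_cast ha0)) ∈ (toPrincipalIdeal (𝓞 K) K).ker := by
    rw [MonoidHom.mem_ker, map_mul, map_inv, hcq, inv_mul_cancel]
  rw [NumberFields.ker_toPrincipalIdeal, NumberFields.mem_unitsRange_iff] at hker
  obtain ⟨u, hu⟩ := hker
  refine ⟨u, ?_⟩
  have hua0 : (u : 𝓞 K) * a ≠ 0 := mul_ne_zero u.ne_zero ha0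
  refine sub_mem_of_unitsMk0_div_mem_rayElements h𝔪' hb0 hua0 ?_
  have heq : Units.mk0 ((b : K) / (((u : 𝓞 K) * a : 𝓞 K) : K))
        (div_ne_zero (by exact_mod_cast hb0) (by exact_mod_cast hua0)) =
      (Units.map (algebraMap (𝓞 K) K : 𝓞 K →* K) u)⁻¹ * Units.mk0 ((b : K) / (a : K))
        (div_ne_zero (by exact_mod_cast hb0) (by exact_mod_cast ha0)) := by
    apply Units.ext
    have haK : (a : K) ≠ 0 := by exact_mod_cast ha0
    have huK : ((u : 𝓞 K) : K) ≠ 0 := by exact_mod_cast u.ne_zero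
    simp only [Units.val_mk0, Units.val_mul, Units.val_inv_eq_inv_val, Units.coe_map, MonoidHom.coe_coe]
    rw [show (algebraMap (𝓞 K) K) (u : 𝓞 K) = ((u : 𝓞 K) : K) from rfl]
    push_cast
    field_simp
  rw [heq, hu, mul_inv_rev, inv_inv, mul_comm, ← mul_assoc, mul_inv_cancel, one_mul]
  exact hc

include h𝔪 h𝔪' h𝔪1 hle hsupp in
/-- ★ **`#ker((𝓞/𝔪')ˣ → (𝓞/𝔪)ˣ) = [P_K^𝔪 : P_K^{𝔪'}] · [U_𝔪¹ : U_{𝔪'}¹]`** for a totally complex `K`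
and `𝔪' ≤ 𝔪 ≠ 𝓞`-proper with the same prime divisors, where `U_𝔫¹ = ker(𝓞ˣ → (𝓞/𝔫)ˣ)` are the global
units `≡ 1 mod 𝔫`: the map "kernel class of `r ≡ 1 mod 𝔪` ↦ `(r)·P^{𝔪'}`" is a surjective homomorphism
onto `P^𝔪/P^{𝔪'}` whose kernel is the image of `U_𝔪¹` (Neukirch's exact sequence (1.11) between two
moduli). [cite: NeukirchANT1999, Ch. VI §1 Prop. (1.9), (1.11), Exercise 13]
[cite: deShalit1987, II.1.9 (p. 43)] -/
theorem natCard_ker_eq_relIndex_ray_mul_relIndex_units :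
    Nat.card (Units.map (Ideal.Quotient.factor hle).toMonoidHom :
        (𝓞 K ⧸ 𝔪')ˣ →* (𝓞 K ⧸ 𝔪)ˣ).ker =
      (ray 𝔪').relIndex (ray (K := K) 𝔪) *
        (Units.map (Ideal.Quotient.mk 𝔪').toMonoidHom : (𝓞 K)ˣ →* (𝓞 K ⧸ 𝔪')ˣ).ker.relIndex
          (Units.map (Ideal.Quotient.mk 𝔪).toMonoidHom : (𝓞 K)ˣ →* (𝓞 K ⧸ 𝔪)ˣ).ker := by
  set red : (𝓞 K ⧸ 𝔪')ˣ →* (𝓞 K ⧸ 𝔪)ˣ := Units.map (Ideal.Quotient.factor hle).toMonoidHom with hred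
  set ρ' : (𝓞 K)ˣ →* (𝓞 K ⧸ 𝔪')ˣ := Units.map (Ideal.Quotient.mk 𝔪').toMonoidHom with hρ'
  set ρ : (𝓞 K)ˣ →* (𝓞 K ⧸ 𝔪)ˣ := Units.map (Ideal.Quotient.mk 𝔪).toMonoidHom with hρ
  have hred_coe : ∀ y : (𝓞 K ⧸ 𝔪')ˣ, ((red y : (𝓞 K ⧸ 𝔪)ˣ) : 𝓞 K ⧸ 𝔪) =
      Ideal.Quotient.factor hle (y : 𝓞 K ⧸ 𝔪') := fun y ↦ rfl
  have hρ'_coe : ∀ u : (𝓞 K)ˣ, ((ρ' u : (𝓞 K ⧸ 𝔪')ˣ) : 𝓞 K ⧸ 𝔪') = Ideal.Quotient.mk 𝔪' (u : 𝓞 K) :=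
    fun u ↦ rfl
  have hρ_coe : ∀ u : (𝓞 K)ˣ, ((ρ u : (𝓞 K ⧸ 𝔪)ˣ) : 𝓞 K ⧸ 𝔪) = Ideal.Quotient.mk 𝔪 (u : 𝓞 K) :=
    fun u ↦ rfl
  have hredρ' : ∀ u : (𝓞 K)ˣ, red (ρ' u) = ρ u := fun u ↦ Units.ext (by
    rw [hred_coe, hρ'_coe, hρ_coe, Ideal.Quotient.factor_mk])
  -- lifts of kernel classes: `r x ∈ 𝓞 K`, a unit mod `𝔪'`, `≡ 1 mod 𝔪`
  have hlift : ∀ x : red.ker, ∃ r : 𝓞 K, Ideal.Quotient.mk 𝔪' r = ((x : (𝓞 K ⧸ 𝔪')ˣ) : 𝓞 K ⧸ 𝔪') :=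
    fun x ↦ Ideal.Quotient.mk_surjective _
  choose r hr using hlift
  have hru : ∀ x : red.ker, IsUnit (Ideal.Quotient.mk 𝔪' (r x)) := fun x ↦ by
    rw [hr]; exact Units.isUnit _
  have hr0 : ∀ x : red.ker, r x ≠ 0 := fun x ↦ ne_zero_of_isUnit_mk h𝔪1 (hru x)
  have hr1 : ∀ x : red.ker, r x - 1 ∈ 𝔪 := fun x ↦ by
    have hx : red x = 1 := x.2
    rw [← Ideal.Quotient.eq, map_one, ← Ideal.Quotient.factor_mk hle, hr, ← hred_coe, hx, Units.val_one]
  have hmem : ∀ x : red.ker, toPrincipalIdeal (𝓞 K) K (Units.mk0 (r x : K) (by exact_mod_cast hr0 x)) ∈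
      ray (K := K) 𝔪 :=
    fun x ↦ Subgroup.mem_map.mpr ⟨_, unitsMk0_mem_rayElements_of_sub_one_mem (hr0 x) (hr1 x), rfl⟩
  -- products: `r (x y) ≡ r x · r y mod 𝔪'`
  have hrmul : ∀ x y : red.ker, r x * r y - r (x * y) ∈ 𝔪' := fun x y ↦ by
    rw [← Ideal.Quotient.eq, map_mul, hr, hr, hr, Subgroup.coe_mul, Units.val_mul]
  -- the homomorphism `Φ : ker → P^𝔪/P^{𝔪'}`, `x ↦ (r x)·P^{𝔪'}`
  let Φ : red.ker →* ↥(ray (K := K) 𝔪) ⧸ (ray 𝔪').subgroupOf (ray (K := K) 𝔪) :=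
    MonoidHom.mk' (fun x ↦ QuotientGroup.mk ⟨_, hmem x⟩) (fun x y ↦ by
      have hxy0 : r x * r y ≠ 0 := mul_ne_zero (hr0 x) (hr0 y)
      have hmemxy : toPrincipalIdeal (𝓞 K) K (Units.mk0 ((r x * r y : 𝓞 K) : K) (by exact_mod_cast hxy0)) ∈
          ray (K := K) 𝔪 := by
        refine Subgroup.mem_map.mpr ⟨_, unitsMk0_mem_rayElements_of_sub_one_mem hxy0 ?_, rfl⟩
        have : r x * r y - 1 = (r x - 1) * r y + (r y - 1) := by ring
        rw [this]
        exact 𝔪.add_mem (𝔪.mul_mem_right _ (hr1 x)) (hr1 y)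
      have step : (QuotientGroup.mk (s := (ray 𝔪').subgroupOf (ray (K := K) 𝔪)) ⟨_, hmem (x * y)⟩ :
          ↥(ray (K := K) 𝔪) ⧸ (ray 𝔪').subgroupOf (ray (K := K) 𝔪)) = QuotientGroup.mk ⟨_, hmemxy⟩ :=
        quotientGroupMk_ray_eq_of_sub_mem h𝔪' (hr0 _) hxy0 (hru _) (hmem _) hmemxy (by
          have : r x * r y - r (x * y) = r x * r y - r (x * y) := rfl
          exact hrmul x y)
      have hprod : (⟨_, hmem x⟩ * ⟨_, hmem y⟩ : ↥(ray (K := K) 𝔪)) = ⟨_, hmemxy⟩ := by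
        apply Subtype.ext
        rw [Subgroup.coe_mul, ← map_mul]
        exact congrArg _ (Units.ext (by simp only [Units.val_mul, Units.val_mk0]; push_cast; ring))
      rw [step, ← hprod, QuotientGroup.mk_mul])
  have hΦ : ∀ x : red.ker, Φ x = QuotientGroup.mk ⟨_, hmem x⟩ := fun x ↦ rfl
  -- `Φ` is surjective: a coset `(a)·P^{𝔪'}`, `a = b/c ≡ 1 mod 𝔪`, comes from `rr = b c'`, `c c' ≡ 1 mod 𝔪'`
  have hΦsurj : Function.Surjective Φ := by
    intro q
    induction q using QuotientGroup.induction_on with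
    | H z =>
      obtain ⟨I, hI⟩ := z
      obtain ⟨a, ha, rfl⟩ := Subgroup.mem_map.mp hI
      obtain ⟨b, c, hb0, hc0, hccop, hbc, -, heq⟩ := exists_eq_div_of_mem_rayElements h𝔪 ha
      have hccop' : IsCoprime (Ideal.span {c}) 𝔪' := by
        rw [LFunctions.isCoprime_iff_forall_not_le h𝔪']
        rw [LFunctions.isCoprime_iff_forall_not_le h𝔪] at hccop
        exact fun v hv ↦ hccop v ((hsupp v).mpr hv)
      obtain ⟨i, hi, j, hj, hij⟩ := Ideal.isCoprime_iff_exists.mp hccop'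
      obtain ⟨c', rfl⟩ := Ideal.mem_span_singleton'.mp hi
      have hcc' : c * c' - 1 ∈ 𝔪' := by
        have : c * c' - 1 = -j := by rw [← hij]; ring
        rw [this]; exact 𝔪'.neg_mem hj
      have hbcop : IsCoprime (Ideal.span {b}) 𝔪 := by
        rw [Ideal.isCoprime_iff_exists] at hccop ⊢
        obtain ⟨i₀, hi₀, j₀, hj₀, hij₀⟩ := hccop
        obtain ⟨d, rfl⟩ := Ideal.mem_span_singleton'.mp hi₀
        refine ⟨d * b, Ideal.mem_span_singleton'.mpr ⟨d, rfl⟩, j₀ - d * (b - c), ?_, by rw [← hij₀]; ring⟩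
        exact 𝔪.sub_mem hj₀ (𝔪.mul_mem_left _ hbc)
      have hbcop' : IsCoprime (Ideal.span {b}) 𝔪' := by
        rw [LFunctions.isCoprime_iff_forall_not_le h𝔪] at hbcop
        rw [LFunctions.isCoprime_iff_forall_not_le h𝔪']
        exact fun v hv ↦ hbcop v ((hsupp v).mpr hv)
      set rr : 𝓞 K := b * c' with hrr
      have hrr0 : rr ≠ 0 := mul_ne_zero hb0 (by
        rintro rfl
        rw [mul_zero, zero_sub] at hcc'
        exact h𝔪1 ((Ideal.eq_top_iff_one _).mpr (by simpa using 𝔪'.neg_mem hcc')))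
      have hrru : IsUnit (Ideal.Quotient.mk 𝔪' rr) := by
        rw [hrr, map_mul]
        refine IsUnit.mul ?_ ?_
        · obtain ⟨i₁, hi₁, j₁, hj₁, hij₁⟩ := Ideal.isCoprime_iff_exists.mp hbcop'
          obtain ⟨d₁, rfl⟩ := Ideal.mem_span_singleton'.mp hi₁
          refine IsUnit.of_mul_eq_one (Ideal.Quotient.mk 𝔪' d₁) ?_
          rw [← map_mul, ← map_one (Ideal.Quotient.mk 𝔪'), Ideal.Quotient.eq]
          have : b * d₁ - 1 = -j₁ := by rw [← hij₁]; ring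
          rw [this]; exact 𝔪'.neg_mem hj₁
        · refine IsUnit.of_mul_eq_one (Ideal.Quotient.mk 𝔪' c) ?_
          rw [← map_mul, ← map_one (Ideal.Quotient.mk 𝔪'), Ideal.Quotient.eq]
          have : c' * c - 1 = -j := by rw [← hij]; ring
          rw [this]; exact 𝔪'.neg_mem hj
      have hrr1 : rr - 1 ∈ 𝔪 := by
        have : rr - 1 = (b - c) * c' + (c * c' - 1) := by rw [hrr]; ring
        rw [this]
        exact 𝔪.add_mem (𝔪.mul_mem_right _ hbc) (hle hcc')
      have hx : red (hrru.unit) = 1 := by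
        apply Units.ext
        rw [hred_coe, IsUnit.unit_spec, Ideal.Quotient.factor_mk, Units.val_one,
          ← map_one (Ideal.Quotient.mk 𝔪), Ideal.Quotient.eq]
        exact hrr1
      refine ⟨⟨hrru.unit, hx⟩, ?_⟩
      have hrx : r ⟨hrru.unit, hx⟩ - rr ∈ 𝔪' := by
        rw [← Ideal.Quotient.eq, hr]
        exact hrru.unit_spec
      have hmemrr : toPrincipalIdeal (𝓞 K) K (Units.mk0 (rr : K) (by exact_mod_cast hrr0)) ∈
          ray (K := K) 𝔪 :=
        Subgroup.mem_map.mpr ⟨_, unitsMk0_mem_rayElements_of_sub_one_mem hrr0 hrr1, rfl⟩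
      have step1 : Φ ⟨hrru.unit, hx⟩ = QuotientGroup.mk ⟨_, hmemrr⟩ := by
        rw [hΦ]
        refine quotientGroupMk_ray_eq_of_sub_mem h𝔪' (hr0 _) hrr0 (hru _) (hmem _) hmemrr ?_
        have : rr - r ⟨hrru.unit, hx⟩ = -(r ⟨hrru.unit, hx⟩ - rr) := by ring
        rw [this]; exact 𝔪'.neg_mem hrx
      rw [step1, QuotientGroup.eq, Subgroup.mem_subgroupOf, Subgroup.coe_mul, Subgroup.coe_inv, ← map_inv,
        ← map_mul]
      have hc'0 : c' ≠ 0 := by rintro rfl; exact hrr0 (by rw [hrr, mul_zero])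
      have hcc'0 : c * c' ≠ 0 := mul_ne_zero hc0 hc'0
      have hq : (Units.mk0 (rr : K) (by exact_mod_cast hrr0))⁻¹ * a =
          (Units.mk0 ((c * c' : 𝓞 K) : K) (by exact_mod_cast hcc'0))⁻¹ := by
        apply Units.ext
        have hbK : (b : K) ≠ 0 := by exact_mod_cast hb0
        have hcK : (c : K) ≠ 0 := by exact_mod_cast hc0
        have hc'K : (c' : K) ≠ 0 := by exact_mod_cast hc'0
        simp only [Units.val_mul, Units.val_inv_eq_inv_val, Units.val_mk0, heq, hrr]
        push_cast
        field_simp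
      rw [hq, map_inv]
      exact inv_mem (Subgroup.mem_map.mpr ⟨_, unitsMk0_mem_rayElements_of_sub_one_mem hcc'0 hcc', rfl⟩)
  -- `ker Φ` is the image of `U_𝔪¹` in `(𝓞/𝔪')ˣ`
  have hkerΦ : Φ.ker.map red.ker.subtype = ρ.ker.map ρ' := by
    ext y
    constructor
    · rintro ⟨x, hx, rfl⟩
      rw [SetLike.mem_coe, MonoidHom.mem_ker, hΦ] at hx
      -- `Φ x = 1 = (1)·P^{𝔪'}` ⟹ `r x ≡ u mod 𝔪'` for a unit `u`
      have hone : toPrincipalIdeal (𝓞 K) K (Units.mk0 ((1 : 𝓞 K) : K) (by simp)) ∈ ray (K := K) 𝔪 :=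
        Subgroup.mem_map.mpr ⟨_, unitsMk0_mem_rayElements_of_sub_one_mem one_ne_zero (by simp), rfl⟩
      have h1 : (QuotientGroup.mk (s := (ray 𝔪').subgroupOf (ray (K := K) 𝔪)) ⟨_, hone⟩ :
          ↥(ray (K := K) 𝔪) ⧸ (ray 𝔪').subgroupOf (ray (K := K) 𝔪)) = 1 := by
        rw [← QuotientGroup.mk_one]
        congr 1
        apply Subtype.ext
        rw [Subgroup.coe_one, ← map_one (toPrincipalIdeal (𝓞 K) K)]
        exact congrArg _ (Units.ext (by simp))
      rw [← h1] at hx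
      obtain ⟨u, hu⟩ := exists_units_sub_mul_mem_of_quotientGroupMk_ray_eq h𝔪' one_ne_zero (hr0 x) hone
        (hmem x) hx.symm
      rw [mul_one] at hu
      refine ⟨u, ?_, ?_⟩
      · -- `u ≡ r x ≡ 1 mod 𝔪`
        rw [SetLike.mem_coe, MonoidHom.mem_ker]
        apply Units.ext
        rw [hρ_coe, Units.val_one, ← map_one (Ideal.Quotient.mk 𝔪), Ideal.Quotient.eq]
        have : (u : 𝓞 K) - 1 = (r x - 1) - (r x - u) := by ring
        rw [this]
        exact 𝔪.sub_mem (hr1 x) (hle hu)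
      · apply Units.ext
        rw [hρ'_coe, Subgroup.coe_subtype, ← hr x, Ideal.Quotient.eq]
        have : (u : 𝓞 K) - r x = -(r x - u) := by ring
        rw [this]
        exact 𝔪'.neg_mem hu
    · rintro ⟨u, hu, rfl⟩
      rw [SetLike.mem_coe, MonoidHom.mem_ker] at hu
      have hx : red (ρ' u) = 1 := by rw [hredρ', hu]
      refine ⟨⟨ρ' u, hx⟩, ?_, rfl⟩
      rw [SetLike.mem_coe, MonoidHom.mem_ker, hΦ, QuotientGroup.eq_one_iff, Subgroup.mem_subgroupOf]
      -- `(r x) = (r x / u) ∈ P^{𝔪'}` since `r x ≡ u mod 𝔪'`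
      have hrxu : r ⟨ρ' u, hx⟩ - u ∈ 𝔪' := by
        rw [← Ideal.Quotient.eq, hr]
        exact hρ'_coe u
      have hdiv : Units.mk0 ((r ⟨ρ' u, hx⟩ : K) / ((u : 𝓞 K) : K))
          (div_ne_zero (by exact_mod_cast hr0 _) (by exact_mod_cast u.ne_zero)) ∈ rayElements 𝔪' :=
        unitsMk0_div_mem_rayElements_of_sub_mem h𝔪' (hr0 _) u.ne_zero
          (by rw [Ideal.span_singleton_eq_top.mpr u.isUnit, ← Ideal.one_eq_top]; exact isCoprime_one_left)
          hrxu
      have heq : toPrincipalIdeal (𝓞 K) K (Units.mk0 (r ⟨ρ' u, hx⟩ : K) (by exact_mod_cast hr0 _)) =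
          toPrincipalIdeal (𝓞 K) K (Units.mk0 ((r ⟨ρ' u, hx⟩ : K) / ((u : 𝓞 K) : K))
            (div_ne_zero (by exact_mod_cast hr0 _) (by exact_mod_cast u.ne_zero))) := by
        have hunit : toPrincipalIdeal (𝓞 K) K (Units.map (algebraMap (𝓞 K) K : 𝓞 K →* K) u) = 1 := by
          rw [← MonoidHom.mem_ker, NumberFields.ker_toPrincipalIdeal, NumberFields.mem_unitsRange_iff]
          exact ⟨u, rfl⟩
        have hfac : Units.mk0 (r ⟨ρ' u, hx⟩ : K) (by exact_mod_cast hr0 _) =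
            Units.mk0 ((r ⟨ρ' u, hx⟩ : K) / ((u : 𝓞 K) : K))
              (div_ne_zero (by exact_mod_cast hr0 _) (by exact_mod_cast u.ne_zero)) *
              Units.map (algebraMap (𝓞 K) K : 𝓞 K →* K) u := by
          apply Units.ext
          have huK : ((u : 𝓞 K) : K) ≠ 0 := by exact_mod_cast u.ne_zero
          simp only [Units.val_mk0, Units.val_mul, Units.coe_map, MonoidHom.coe_coe]
          rw [div_mul_cancel₀ _ huK]
        rw [hfac, map_mul, hunit, mul_one]
      have hgoal : toPrincipalIdeal (𝓞 K) K (Units.mk0 (r ⟨ρ' u, hx⟩ : K) (by exact_mod_cast hr0 _)) ∈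
          ray (K := K) 𝔪' := by
        rw [heq]
        exact Subgroup.mem_map.mpr ⟨_, hdiv, rfl⟩
      exact hgoal
  -- count: `#ker red = #range Φ · #ker Φ = [P^𝔪 : P^{𝔪'}] · #(U_𝔪¹ mod 𝔪')`
  have hcount : Nat.card red.ker = Φ.ker.index * Nat.card Φ.ker := (Subgroup.index_mul_card Φ.ker).symm
  rw [hcount, Subgroup.index_ker, MonoidHom.range_eq_top.mpr hΦsurj, Subgroup.card_top,
    ← Subgroup.card_subtype red.ker Φ.ker, hkerΦ, ← Subgroup.relIndex_ker]
  rfl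

include h𝔪 h𝔪' h𝔪1 hle hsupp in
/-- ★★ **`#Cl_K^{𝔪'} · [U_𝔪¹ : U_{𝔪'}¹] = #Cl_K^{𝔪} · #ker((𝓞/𝔪')ˣ → (𝓞/𝔪)ˣ)`** for a totally
complex `K` and `𝔪' ≤ 𝔪` proper with the same prime divisors (`U_𝔫¹ = ker(𝓞ˣ → (𝓞/𝔫)ˣ)`): the exact
sequence `1 → U_𝔪¹/U_{𝔪'}¹ → ker((𝓞/𝔪')ˣ → (𝓞/𝔪)ˣ) → Cl^{𝔪'} → Cl^𝔪 → 1` in cardinality form —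
`RayClassGroupModulusChange.natCard_rayClassGroup_eq_mul_natCard_ker` without the hypothesis
`w_𝔪 = 1`. [cite: NeukirchANT1999, Ch. VI §1 Prop. (1.9), (1.11), Exercise 13]
[cite: deShalit1987, II.1.9 (p. 43)] -/
theorem natCard_rayClassGroup_mul_relIndex_units_eq :
    Nat.card (RayClassGroup 𝔪') *
        (Units.map (Ideal.Quotient.mk 𝔪').toMonoidHom : (𝓞 K)ˣ →* (𝓞 K ⧸ 𝔪')ˣ).ker.relIndex
          (Units.map (Ideal.Quotient.mk 𝔪).toMonoidHom : (𝓞 K)ˣ →* (𝓞 K ⧸ 𝔪)ˣ).ker =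
      Nat.card (RayClassGroup 𝔪) *
        Nat.card (Units.map (Ideal.Quotient.factor hle).toMonoidHom :
          (𝓞 K ⧸ 𝔪')ˣ →* (𝓞 K ⧸ 𝔪)ˣ).ker := by
  rw [natCard_ker_eq_relIndex_ray_mul_relIndex_units h𝔪 h𝔪' h𝔪1 hle hsupp, natCard_rayClassGroup_eq_relIndex,
    natCard_rayClassGroup_eq_relIndex, relIndex_ray_eq_mul h𝔪 h𝔪' (Ideal.dvd_iff_le.mpr hle) hsupp]
  ring

end Kernel

end Literature.NumberTheory.GaloisRepresentations

end
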